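import Mathlib.Analysis.SpecialFunctions.Elliptic.Weierstrass
import HarnessLib

/-!
# Line `star` (crux E1M, stmt-BirchSwinnertonDyer-20341), stub `StarPlusOddClass` — helper 1: the mod-2 parity of real parts in a
# period lattice («`{λ ∈ Λ : Re λ ∈ 2ρℤ} = ℤμ + 2Λ`»)

Lead bsd-rank2-star-p1 GEN 4.  Pure lattice bookkeeping, no elliptic functions: let `Λ = ℤω₁ ⊕ ℤω₂ ⊂ ℂ` be the lattice of a Mathlib
`PeriodPair`, and suppose the real parts of `Λ` lie in `ρℤ` (`ρ ≠ 0`) with `ρ` itself attained (`Re z₁ = ρ`, `z₁ ∈ Λ`) — for the Néron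
lattice `q·Λ_f` of an optimal elliptic curve this is `ρ = q·Ω⁺_f/2` (`re Λ_f = ℤ·Ω⁺_f/2`, definition of `plusPeriod`).  Let `μ ∈ Λ` be a
PURELY IMAGINARY period with `μ/2 ∉ Λ` (the primitive imaginary period, or any odd multiple of it).  Then for `z ∈ Λ` with `Re z = kρ`:
`k` is EVEN iff `z ∈ ℤμ + 2Λ`.  [The character `z ↦ k mod 2` is onto `ℤ/2` (value `1` at `z₁`), kills `2Λ` and `μ`, and `[Λ : 2Λ] = 4`, so
its kernel is `ℤμ + 2Λ`; in coordinates this is the statement that a line through the origin of `𝔽₂²` has exactly one non-zero point.]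
This is step (ii) of the road to `StarPlusOddClass` (Lines/star.lean v4.0): with `μ` the primitive imaginary period, `℘_Λ(μ/2) − b₂/12` is the
LEAST real root of the 2-division cubic (step (iii), analytic), and `k = 2·X_f(b,d)` for `z = q·{0, b/d}_f` (step (i), tree
`plusFunctional_halfIntegral_and_odd`), so «`2X_f(b,d)` even ⟺ `EvenOnLoop f q L μ b d`».
-/

set_option linter.dupNamespace false

namespace Summit.BirchSwinnertonDyer.BirchSwinnertonDyer.Theorems.DepletionAtTwo

open PeriodPair

/-- The `𝔽₂`-linear-algebra core: for `(k₁, k₂) ≠ 0` in `𝔽₂²` the solutions of `x k₁ + y k₂ = 0` are `0` and any one non-zero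
solution `(m₁, m₂)`. [folklore] -/
theorem zmod_two_line_solutions (k₁ k₂ m₁ m₂ a b : ZMod 2) (hk : ¬ (k₁ = 0 ∧ k₂ = 0))
    (hm0 : ¬ (m₁ = 0 ∧ m₂ = 0)) (hm : m₁ * k₁ + m₂ * k₂ = 0) (hab : a * k₁ + b * k₂ = 0) :
    (a = 0 ∧ b = 0) ∨ (a = m₁ ∧ b = m₂) := by
  revert k₁ k₂ m₁ m₂ a b
  decide

/-- **Parity of real parts in a period lattice.** Let `Λ` be the lattice of a period pair, `ρ ≠ 0` real with `Re Λ ⊆ ρℤ` and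
`Re z₁ = ρ` for some `z₁ ∈ Λ`, and `μ ∈ Λ` purely imaginary with `μ/2 ∉ Λ`.  Then a period `z` with `Re z = kρ` has `k` even iff
`z ∈ ℤμ + 2Λ`.  (For the Néron lattice `q·Λ_f` of an optimal curve, `ρ = qΩ⁺_f/2` and `μ` the primitive imaginary period, this is
«`2·X_f(b,d)` even ⟺ the loop `{0, b/d}` pairs evenly with the 2-torsion point `μ/2`», step (ii) of `StarPlusOddClass`.) [folklore] -/
theorem lattice_re_parity_iff (L : PeriodPair) {ρ : ℝ} (hρ : ρ ≠ 0)
    (hre : ∀ z ∈ L.lattice, ∃ k : ℤ, z.re = k * ρ) {z₁ : ℂ} (hz₁ : z₁ ∈ L.lattice) (hz₁re : z₁.re = ρ)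
    {μ : ℂ} (hμ : μ ∈ L.lattice) (hμre : μ.re = 0) (hμ2 : μ / 2 ∉ L.lattice)
    {z : ℂ} (hz : z ∈ L.lattice) {k : ℤ} (hk : z.re = k * ρ) :
    Even k ↔ ∃ j : ℤ, ∃ w ∈ L.lattice, z = j * μ + 2 * w := by
  constructor
  · intro hkev
    -- coordinates
    obtain ⟨a, b, hzab⟩ := mem_lattice.mp hz
    obtain ⟨m₁, m₂, hμm⟩ := mem_lattice.mp hμ
    obtain ⟨c₁, c₂, hz₁c⟩ := mem_lattice.mp hz₁
    obtain ⟨k₁, hk₁⟩ := hre L.ω₁ L.ω₁_mem_lattice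
    obtain ⟨k₂, hk₂⟩ := hre L.ω₂ L.ω₂_mem_lattice
    -- real parts in units of `ρ`
    have hre_comb : ∀ (s t : ℤ), (s * L.ω₁ + t * L.ω₂ : ℂ).re = (s * k₁ + t * k₂ : ℤ) * ρ := by
      intro s t
      simp only [Complex.add_re, Complex.mul_re, Complex.intCast_re, Complex.intCast_im, zero_mul, sub_zero, hk₁, hk₂]
      push_cast
      ring
    have hk' : k = a * k₁ + b * k₂ := by
      have h : (k : ℝ) * ρ = (a * k₁ + b * k₂ : ℤ) * ρ := by rw [← hk, ← hzab, hre_comb]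
      exact_mod_cast mul_right_cancel₀ hρ h
    have hm' : m₁ * k₁ + m₂ * k₂ = 0 := by
      have h : ((m₁ * k₁ + m₂ * k₂ : ℤ) : ℝ) * ρ = 0 := by rw [← hre_comb, hμm, hμre]
      exact_mod_cast (mul_eq_zero.mp h).resolve_right hρ
    have hc' : c₁ * k₁ + c₂ * k₂ = 1 := by
      have h : ((c₁ * k₁ + c₂ * k₂ : ℤ) : ℝ) * ρ = 1 * ρ := by rw [← hre_comb, hz₁c, hz₁re, one_mul]
      exact_mod_cast mul_right_cancel₀ hρ h
    -- `μ/2 ∉ Λ`: `m₁, m₂` not both even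
    have hm0 : ¬ ((m₁ : ZMod 2) = 0 ∧ (m₂ : ZMod 2) = 0) := by
      rintro ⟨h1, h2⟩
      obtain ⟨p, hp⟩ := (ZMod.intCast_zmod_eq_zero_iff_dvd m₁ 2).mp h1
      obtain ⟨p', hp'⟩ := (ZMod.intCast_zmod_eq_zero_iff_dvd m₂ 2).mp h2
      apply hμ2
      have : μ / 2 = (p : ℂ) * L.ω₁ + (p' : ℂ) * L.ω₂ := by
        rw [← hμm, hp, hp']; push_cast; ring
      rw [this]
      exact mem_lattice.mpr ⟨p, p', rfl⟩
    -- `(k₁, k₂)` not both even (`c₁k₁ + c₂k₂ = 1`)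
    have hk0 : ¬ ((k₁ : ZMod 2) = 0 ∧ (k₂ : ZMod 2) = 0) := by
      rintro ⟨h1, h2⟩
      have h : ((c₁ * k₁ + c₂ * k₂ : ℤ) : ZMod 2) = 1 := by rw [hc']; simp
      have h' : ((c₁ * k₁ + c₂ * k₂ : ℤ) : ZMod 2) = 0 := by push_cast; rw [h1, h2]; ring
      exact zero_ne_one (h'.symm.trans h)
    have hmZ : (m₁ : ZMod 2) * k₁ + (m₂ : ZMod 2) * k₂ = 0 := by exact_mod_cast congrArg (Int.cast : ℤ → ZMod 2) hm'
    have hkZ : (a : ZMod 2) * k₁ + (b : ZMod 2) * k₂ = 0 := by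
      have h2 : (k : ZMod 2) = 0 := (ZMod.intCast_zmod_eq_zero_iff_dvd k 2).mpr (even_iff_two_dvd.mp hkev)
      have := congrArg (Int.cast : ℤ → ZMod 2) hk'
      push_cast at this
      rw [← this, h2]
    rcases zmod_two_line_solutions _ _ _ _ _ _ hk0 hm0 hmZ hkZ with ⟨ha, hb⟩ | ⟨ha, hb⟩
    · obtain ⟨p, hp⟩ := (ZMod.intCast_zmod_eq_zero_iff_dvd a 2).mp ha
      obtain ⟨p', hp'⟩ := (ZMod.intCast_zmod_eq_zero_iff_dvd b 2).mp hb
      refine ⟨0, (p : ℂ) * L.ω₁ + (p' : ℂ) * L.ω₂, mem_lattice.mpr ⟨p, p', rfl⟩, ?_⟩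
      rw [← hzab, hp, hp']; push_cast; ring
    · obtain ⟨p, hp⟩ := (ZMod.intCast_eq_intCast_iff_dvd_sub m₁ a 2).mp ha.symm
      obtain ⟨p', hp'⟩ := (ZMod.intCast_eq_intCast_iff_dvd_sub m₂ b 2).mp hb.symm
      refine ⟨1, (p : ℂ) * L.ω₁ + (p' : ℂ) * L.ω₂, mem_lattice.mpr ⟨p, p', rfl⟩, ?_⟩
      have ha' : (a : ℂ) = m₁ + 2 * p := by
        have : a = m₁ + 2 * p := by push_cast at hp; omega
        rw [this]; push_cast; ring
      have hb' : (b : ℂ) = m₂ + 2 * p' := by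
        have : b = m₂ + 2 * p' := by push_cast at hp'; omega
        rw [this]; push_cast; ring
      rw [← hzab, ← hμm, ha', hb']; push_cast; ring
  · rintro ⟨j, w, hw, hzw⟩
    obtain ⟨kw, hkw⟩ := hre w hw
    have h : (k : ℝ) * ρ = (2 * kw : ℤ) * ρ := by
      rw [← hk, hzw]
      simp only [Complex.add_re, Complex.mul_re, Complex.intCast_re, Complex.intCast_im, hμre, hkw,
        Complex.re_ofNat, Complex.im_ofNat]
      push_cast
      ring
    have : k = 2 * kw := by exact_mod_cast mul_right_cancel₀ hρ h
    exact ⟨kw, by rw [this]; ring⟩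

end Summit.BirchSwinnertonDyer.BirchSwinnertonDyer.Theorems.DepletionAtTwo
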